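import Mathlib
import Summits.Ventures.PercRepro2.CoinChainCleanBase

/-!
# The universal PURE chain from the clean-state base bound
(blind cell PercRepro2, night-2 g23; proofs/NIGHT2-DARC.md §63.13)

`gate_functional_ge_baseY` (CoinChainCleanBase) for the world-1 pair of the pure AND-switch
chain gives `m·U111 ≥ (b0 yI − m b2)·(b0 g1 − b1 g0)` (`pureChain_U111_ge_baseY`): the world-1
functional is at least the product of the ideal `y`-shift and the gate's `x`-excess — nontrivial
exactly when the gate LOWERS the `x`-mean, the regime `CoinChainPivotalMean` leaves open.  Hence
`pureChain_functional_nonneg_of_cslBaseY`: the pure chain at EVERY `ρ ∈ [0, 1]` whenever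
`a0²·(b0 yI − m b2)(b0 g1 − b1 g0) + m·(b0 − g0)·Δ ≥ 0`.
-/

namespace Summit.Ventures.PercRepro2.Coin

open Classical

section CleanBaseChain

variable {V : Type*} [DecidableEq V] {R : Type*} [Field R] [LinearOrder R] [IsStrictOrderedRing R]

/-- **THE CLEAN-STATE BASE BOUND FOR THE PURE CHAIN**: with `m, yI` the ideal mass and `y`-moment
of `ν c`, `m·U111 ≥ (b0 yI − m b2)·(b0 g1 − b1 g0)`. -/
theorem pureChain_U111_ge_baseY (U ent' : Finset V) (ν c d d' : Finset V → R)
    (hν0 : ∀ W, 0 ≤ ν W)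
    (hν : ∀ s ⊆ U, ∀ t ⊆ U, ν s * ν t ≤ ν (s ∩ t) * ν (s ∪ t))
    (hc0 : ∀ W, 0 ≤ c W) (hd0 : ∀ W, 0 ≤ d W) (hd'0 : ∀ W, 0 ≤ d' W)
    (hdc : ∀ W, d W ≤ c W) (hd'c : ∀ W, d' W ≤ c W)
    (hcc : ∀ s t, c s * c t ≤ c (s ∩ t) * c (s ∪ t))
    (hdd : ∀ s t, d s * d t ≤ d (s ∩ t) * d (s ∪ t))
    (hd'd' : ∀ s t, d' s * d' t ≤ d' (s ∩ t) * d' (s ∪ t))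
    (hcd : ∀ s t, c s * d t ≤ c (s ∩ t) * d (s ∪ t))
    (hcd' : ∀ s t, c s * d' t ≤ c (s ∩ t) * d' (s ∪ t))
    (hdd' : ∀ s t, d s * d' t ≤ d (s ∩ t) * d' (s ∪ t))
    (hratio : ∀ s t, s ⊆ t → d s * c t ≤ c s * d t)
    (hratio' : ∀ s t, s ⊆ t → d' s * c t ≤ c s * d' t)
    (x y : Finset V → R) (hx0 : ∀ W, 0 ≤ x W) (hy0 : ∀ W, 0 ≤ y W)
    (hxm : ∀ s t, x s ≤ x (s ∪ t)) (hym : ∀ s t, y s ≤ y (s ∪ t)) :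
    ((∑ W ∈ U.powerset, ν W * chainMix ∅ ent' 1 c d W) *
        (∑ W ∈ U.powerset.filter (fun W => W ∩ ent' = ∅), ν W * c W * y W)
      - (∑ W ∈ U.powerset, ν W * chainMix ∅ ent' 1 c d W * y W) *
        (∑ W ∈ U.powerset.filter (fun W => W ∩ ent' = ∅), ν W * c W)) *
      ((∑ W ∈ U.powerset, ν W * chainMix ∅ ent' 1 c d W) *
          (∑ W ∈ U.powerset, ν W * chainMix ∅ ent' 1 c d' W * x W)
        - (∑ W ∈ U.powerset, ν W * chainMix ∅ ent' 1 c d W * x W) *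
          (∑ W ∈ U.powerset, ν W * chainMix ∅ ent' 1 c d' W)) ≤
    (∑ W ∈ U.powerset.filter (fun W => W ∩ ent' = ∅), ν W * c W) *
      ((∑ W ∈ U.powerset, ν W * chainMix ∅ ent' 1 c d W) ^ 2 *
          (∑ W ∈ U.powerset, ν W * chainMix ∅ ent' 1 c d' W * (x W * y W))
        - (∑ W ∈ U.powerset, ν W * chainMix ∅ ent' 1 c d W) *
          (∑ W ∈ U.powerset, ν W * chainMix ∅ ent' 1 c d W * x W) *
          (∑ W ∈ U.powerset, ν W * chainMix ∅ ent' 1 c d' W * y W)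
        - (∑ W ∈ U.powerset, ν W * chainMix ∅ ent' 1 c d W) *
          (∑ W ∈ U.powerset, ν W * chainMix ∅ ent' 1 c d W * y W) *
          (∑ W ∈ U.powerset, ν W * chainMix ∅ ent' 1 c d' W * x W)
        + (∑ W ∈ U.powerset, ν W * chainMix ∅ ent' 1 c d W * x W) *
          (∑ W ∈ U.powerset, ν W * chainMix ∅ ent' 1 c d W * y W) *
          (∑ W ∈ U.powerset, ν W * chainMix ∅ ent' 1 c d' W)) := by
  set G : Finset V → R := fun W => ν W * chainMix ∅ ent' 1 c d W with hGdef
  set G' : Finset V → R := fun W => ν W * chainMix ∅ ent' 1 c d' W with hG'def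
  have hm0 : ∀ W, 0 ≤ chainMix ∅ ent' 1 c d W := chainMix_nonneg ∅ ent' zero_le_one le_rfl hc0 hd0
  have hm'0 : ∀ W, 0 ≤ chainMix ∅ ent' 1 c d' W := chainMix_nonneg ∅ ent' zero_le_one le_rfl hc0 hd'0
  have hG0 : ∀ W, 0 ≤ G W := fun W => mul_nonneg (hν0 W) (hm0 W)
  have hG'0 : ∀ W, 0 ≤ G' W := fun W => mul_nonneg (hν0 W) (hm'0 W)
  have hmix := mixture_lsm ∅ ent' 1 zero_le_one le_rfl c d hc0 hd0 hdc hcc hdd hcd hratio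
  have hmix' := mixture_lsm ∅ ent' 1 zero_le_one le_rfl c d' hc0 hd'0 hd'c hcc hd'd' hcd' hratio'
  have wLL : ∀ s ⊆ U, ∀ t ⊆ U, G s * G t ≤ G (s ∩ t) * G (s ∪ t) := by
    intro s hs t ht
    simp only [hGdef]
    calc ν s * chainMix ∅ ent' 1 c d s * (ν t * chainMix ∅ ent' 1 c d t)
        = (ν s * ν t) * (chainMix ∅ ent' 1 c d s * chainMix ∅ ent' 1 c d t) := by ring
      _ ≤ (ν (s ∩ t) * ν (s ∪ t)) * (chainMix ∅ ent' 1 c d (s ∩ t) * chainMix ∅ ent' 1 c d (s ∪ t)) :=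
          mul_le_mul (hν s hs t ht) (hmix s t) (mul_nonneg (hm0 _) (hm0 _)) (mul_nonneg (hν0 _) (hν0 _))
      _ = _ := by ring
  have wMM : ∀ s ⊆ U, ∀ t ⊆ U, G' s * G' t ≤ G' (s ∩ t) * G' (s ∪ t) := by
    intro s hs t ht
    simp only [hG'def]
    calc ν s * chainMix ∅ ent' 1 c d' s * (ν t * chainMix ∅ ent' 1 c d' t)
        = (ν s * ν t) * (chainMix ∅ ent' 1 c d' s * chainMix ∅ ent' 1 c d' t) := by ring
      _ ≤ (ν (s ∩ t) * ν (s ∪ t)) * (chainMix ∅ ent' 1 c d' (s ∩ t) * chainMix ∅ ent' 1 c d' (s ∪ t)) :=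
          mul_le_mul (hν s hs t ht) (hmix' s t) (mul_nonneg (hm'0 _) (hm'0 _)) (mul_nonneg (hν0 _) (hν0 _))
      _ = _ := by ring
  have wML : ∀ s ⊆ U, ∀ t ⊆ U, (∃ r ∈ ent', r ∈ s) → G' s * G t ≤ G (s ∩ t) * G' (s ∪ t) := by
    intro s hs t ht hse
    have hse' : ∃ r ∈ (∅ : Finset V) ∪ ent', r ∈ s := by
      obtain ⟨r, hr, hrs⟩ := hse; exact ⟨r, Finset.mem_union_right _ hr, hrs⟩
    have hsu : ∃ r ∈ (∅ : Finset V) ∪ ent', r ∈ s ∪ t := by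
      obtain ⟨r, hr, hrs⟩ := hse'; exact ⟨r, hr, Finset.mem_union_left _ hrs⟩
    simp only [hGdef, hG'def]
    rw [chainMix_one_of_meet ∅ ent' c d' hse', chainMix_one_of_meet ∅ ent' c d' hsu]
    calc ν s * d' s * (ν t * chainMix ∅ ent' 1 c d t)
        = (ν s * ν t) * (d' s * chainMix ∅ ent' 1 c d t) := by ring
      _ ≤ (ν (s ∩ t) * ν (s ∪ t)) * (chainMix ∅ ent' 1 c d (s ∩ t) * d' (s ∪ t)) :=
          mul_le_mul (hν s hs t ht)
            (chain_cross_holley ∅ ent' 1 zero_le_one le_rfl c d d' hdc hcd' hdd' hd'0 s t)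
            (mul_nonneg (hd'0 _) (hm0 _)) (mul_nonneg (hν0 _) (hν0 _))
      _ = _ := by ring
  have hno : ∀ W : Finset V, W ∩ ent' = ∅ → ¬ ∃ r ∈ (∅ : Finset V) ∪ ent', r ∈ W := by
    intro W hW
    rintro ⟨r, hr, hrW⟩
    have hr' : r ∈ ent' := by simpa using hr
    have : r ∈ W ∩ ent' := Finset.mem_inter.mpr ⟨hrW, hr'⟩
    rw [hW] at this
    exact Finset.notMem_empty r this
  have hI : ∀ W, W ∩ ent' = ∅ → G' W = G W := by
    intro W hW
    simp only [hGdef, hG'def]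
    rw [chainMix_of_not_meet ∅ ent' 1 c d (hno W hW), chainMix_of_not_meet ∅ ent' 1 c d' (hno W hW)]
  have key := gate_functional_ge_baseY U ent' G G' x y hG0 hG'0 hx0 hy0 hxm hym wLL wMM wML hI
  -- the ideal sums of the gate are those of `ν c`
  have eN : (∑ W ∈ U.powerset.filter (fun W => W ∩ ent' = ∅), G' W) =
      ∑ W ∈ U.powerset.filter (fun W => W ∩ ent' = ∅), ν W * c W := by
    refine Finset.sum_congr rfl fun W hW => ?_
    simp only [hG'def]
    rw [chainMix_of_not_meet ∅ ent' 1 c d' (hno W (Finset.mem_filter.1 hW).2)]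
  have eNy : (∑ W ∈ U.powerset.filter (fun W => W ∩ ent' = ∅), G' W * y W) =
      ∑ W ∈ U.powerset.filter (fun W => W ∩ ent' = ∅), ν W * c W * y W := by
    refine Finset.sum_congr rfl fun W hW => ?_
    simp only [hG'def]
    rw [chainMix_of_not_meet ∅ ent' 1 c d' (hno W (Finset.mem_filter.1 hW).2)]
  rw [eN, eNy] at key
  exact key

/-- (Q′) from the clean-state base bound: the algebra. -/
lemma qprime_of_cslBase_alg (a0 a1 a2 b0 b1 b2 g0 g1 g2 g12 m yI : R) (hm : 0 < m)
    (hbase : (b0 * yI - b2 * m) * (b0 * g1 - b1 * g0) ≤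
      m * (b0 * b0 * g12 - b0 * b1 * g2 - b0 * b2 * g1 + b1 * b2 * g0))
    (hsign : 0 ≤ a0 ^ 2 * ((b0 * yI - m * b2) * (b0 * g1 - b1 * g0))
      + m * ((b0 - g0) * ((b0 * a1 - a0 * b1) * (b0 * a2 - a0 * b2)))) :
    0 ≤ a0 ^ 2 * (b0 * b0 * g12 - b0 * b2 * g1 - b0 * b1 * g2 + b1 * b2 * g0)
      + (b0 - g0) * ((b0 * a1 - a0 * b1) * (b0 * a2 - a0 * b2)) := by
  have h1 := mul_le_mul_of_nonneg_left hbase (sq_nonneg a0)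
  have h2 : 0 ≤ m * (a0 ^ 2 * (b0 * b0 * g12 - b0 * b2 * g1 - b0 * b1 * g2 + b1 * b2 * g0)
      + (b0 - g0) * ((b0 * a1 - a0 * b1) * (b0 * a2 - a0 * b2))) := by nlinarith [h1, hsign]
  exact (mul_nonneg_iff_of_pos_left hm).mp h2

/-- **THE UNIVERSAL PURE CHAIN FROM THE CLEAN-STATE BASE BOUND (`y`-layer cake).** Notation as in
`pureChain_functional_nonneg_of_Qstar`; under the head hypotheses, positive world masses and a
positive ideal mass, the sign condition
`a0²·(b0 yI − m b2)(b0 g1 − b1 g0) + m·(b0 − g0)·Δ ≥ 0` implies the pure chain functional at EVERY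
`ρ ∈ [0, 1]` for every pair of nonnegative increasing markers.  (In the anti-aligned pattern with
the gate lowering the `x`-mean, `g1 < p₁ g0`: the product of the ideal `y`-shift and the gate's
`x`-deficit pays the pivotal need.) -/
theorem pureChain_functional_nonneg_of_cslBaseY (U ent' : Finset V) (ν c d d' : Finset V → R)
    (ρ : R) (hρ0 : 0 ≤ ρ) (hρ1 : ρ ≤ 1) (hν0 : ∀ W, 0 ≤ ν W)
    (hν : ∀ s ⊆ U, ∀ t ⊆ U, ν s * ν t ≤ ν (s ∩ t) * ν (s ∪ t))
    (hc0 : ∀ W, 0 ≤ c W) (hd0 : ∀ W, 0 ≤ d W) (hd'0 : ∀ W, 0 ≤ d' W)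
    (hdc : ∀ W, d W ≤ c W) (hd'c : ∀ W, d' W ≤ c W)
    (hcc : ∀ s t, c s * c t ≤ c (s ∩ t) * c (s ∪ t))
    (hdd : ∀ s t, d s * d t ≤ d (s ∩ t) * d (s ∪ t))
    (hd'd' : ∀ s t, d' s * d' t ≤ d' (s ∩ t) * d' (s ∪ t))
    (hcd : ∀ s t, c s * d t ≤ c (s ∩ t) * d (s ∪ t))
    (hcd' : ∀ s t, c s * d' t ≤ c (s ∩ t) * d' (s ∪ t))
    (hdd' : ∀ s t, d s * d' t ≤ d (s ∩ t) * d' (s ∪ t))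
    (hratio : ∀ s t, s ⊆ t → d s * c t ≤ c s * d t)
    (hratio' : ∀ s t, s ⊆ t → d' s * c t ≤ c s * d' t)
    (x y : Finset V → R) (hx0 : ∀ W, 0 ≤ x W) (hy0 : ∀ W, 0 ≤ y W)
    (hxm : ∀ s t, x s ≤ x (s ∪ t)) (hym : ∀ s t, y s ≤ y (s ∪ t))
    (hpos0 : 0 < ∑ W ∈ U.powerset, ν W * c W)
    (hpos1 : 0 < ∑ W ∈ U.powerset, ν W * chainMix ∅ ent' 1 c d W)
    (hmI : 0 < ∑ W ∈ U.powerset.filter (fun W => W ∩ ent' = ∅), ν W * c W)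
    (hsign : 0 ≤ (∑ W ∈ U.powerset, ν W * c W) ^ 2 *
        (((∑ W ∈ U.powerset, ν W * chainMix ∅ ent' 1 c d W) *
            (∑ W ∈ U.powerset.filter (fun W => W ∩ ent' = ∅), ν W * c W * y W)
          - (∑ W ∈ U.powerset.filter (fun W => W ∩ ent' = ∅), ν W * c W) *
            (∑ W ∈ U.powerset, ν W * chainMix ∅ ent' 1 c d W * y W)) *
         ((∑ W ∈ U.powerset, ν W * chainMix ∅ ent' 1 c d W) *
            (∑ W ∈ U.powerset, ν W * chainMix ∅ ent' 1 c d' W * x W)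
          - (∑ W ∈ U.powerset, ν W * chainMix ∅ ent' 1 c d W * x W) *
            (∑ W ∈ U.powerset, ν W * chainMix ∅ ent' 1 c d' W)))
        + (∑ W ∈ U.powerset.filter (fun W => W ∩ ent' = ∅), ν W * c W) *
          (((∑ W ∈ U.powerset, ν W * chainMix ∅ ent' 1 c d W) -
              (∑ W ∈ U.powerset, ν W * chainMix ∅ ent' 1 c d' W)) *
            (((∑ W ∈ U.powerset, ν W * chainMix ∅ ent' 1 c d W) * (∑ W ∈ U.powerset, ν W * c W * x W)
                - (∑ W ∈ U.powerset, ν W * c W) * (∑ W ∈ U.powerset, ν W * chainMix ∅ ent' 1 c d W * x W)) *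
              ((∑ W ∈ U.powerset, ν W * chainMix ∅ ent' 1 c d W) * (∑ W ∈ U.powerset, ν W * c W * y W)
                - (∑ W ∈ U.powerset, ν W * c W) * (∑ W ∈ U.powerset, ν W * chainMix ∅ ent' 1 c d W * y W))))) :
    0 ≤ (∑ W ∈ U.powerset, ν W * chainMix ∅ ent' ρ c d W) ^ 2 *
          (∑ W ∈ U.powerset, ν W * chainMix ∅ ent' ρ c d' W * (x W * y W))
        - (∑ W ∈ U.powerset, ν W * chainMix ∅ ent' ρ c d W) *
          (∑ W ∈ U.powerset, ν W * chainMix ∅ ent' ρ c d W * x W) *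
          (∑ W ∈ U.powerset, ν W * chainMix ∅ ent' ρ c d' W * y W)
        - (∑ W ∈ U.powerset, ν W * chainMix ∅ ent' ρ c d W) *
          (∑ W ∈ U.powerset, ν W * chainMix ∅ ent' ρ c d W * y W) *
          (∑ W ∈ U.powerset, ν W * chainMix ∅ ent' ρ c d' W * x W)
        + (∑ W ∈ U.powerset, ν W * chainMix ∅ ent' ρ c d W * x W) *
          (∑ W ∈ U.powerset, ν W * chainMix ∅ ent' ρ c d W * y W) *
          (∑ W ∈ U.powerset, ν W * chainMix ∅ ent' ρ c d' W) := by
  have hbase := pureChain_U111_ge_baseY U ent' ν c d d' hν0 hν hc0 hd0 hd'0 hdc hd'c hcc hdd hd'd'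
    hcd hcd' hdd' hratio hratio' x y hx0 hy0 hxm hym
  have hsq : (∑ W ∈ U.powerset, ν W * chainMix ∅ ent' 1 c d W) ^ 2 =
      (∑ W ∈ U.powerset, ν W * chainMix ∅ ent' 1 c d W) * (∑ W ∈ U.powerset, ν W * chainMix ∅ ent' 1 c d W) :=
    sq _
  rw [hsq] at hbase
  have hQ := qprime_of_cslBase_alg _ _ _ _ _ _ _ _ _ _ _ _ hmI hbase hsign
  exact pureChain_functional_nonneg_of_Qprime U ent' ν c d d' ρ hρ0 hρ1 hν0 hν hc0 hd0 hd'0 hdc hd'c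
    hcc hdd hd'd' hcd hcd' hdd' hratio hratio' x y hx0 hy0 hxm hym hpos0 hpos1 hQ

end CleanBaseChain

end Summit.Ventures.PercRepro2.Coin
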